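/-
Copyright (c) 2026 The HCML crux team. All rights reserved.
Released under Apache 2.0 license as described in the file LICENSE.
Authors: K2E5-p17 (g5) (explicit-unit `hodgecm-mathlib-K2E5-p17-g5`) — the `N = 2` twin, statement for statement, of ★ (GL-5) `K2E3GL3TorusAveraging` by K2E3-p23 (g4)
-/
import Summits.HodgeConjecture.HodgeConjecture.Theorems.K2E3GL2FinConjBoxes          -- ★ (2E-a1) p858857 (this seat): `diffSq_torusRow_mul`, `coe_diagonalGL_mul_apply`; brings ★ (2F-a) `mk_mem_image_iff`, `isOpen_image_mk`
import Summits.HodgeConjecture.HodgeConjecture.Theorems.K2E3TorusOneAveraging         -- ★ (FC-5b) p857248 (K2E2-p13 (g3)): §1 generic `measure_mul_setLIntegral_le_measure_mul_iSup`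
import Summits.HodgeConjecture.HodgeConjecture.Theorems.K2E3UnitsQuadraticFibre        -- ★ (GL-D2) p857449 (K2E3-p21 (g4)): `unitsQuadraticFibre`
import Summits.HodgeConjecture.HodgeConjecture.Theorems.K2E3SplitTorusTwistModuleBound   -- ★ p856900 (K2E3-p20 (g4)): `v_le_iff_normAbs_le`, `normAbs_uniformizer_pow`
import Literature.NumberTheory.Automorphic.TateLocalFactorsProofs                        -- ★ `isOpen_units_valuation_eq_one`, `isCompact_units_valuation_eq_one`
import Literature.NumberTheory.Automorphic.AnisotropicUnitaryGroupCompact                -- ★ `HermitianLattice.isOpen_setOf_v_le_exp_int`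
import Summits.HodgeConjecture.HodgeConjecture.Theorems.K2E3GL3TorusAveraging         -- ★ (GL-5) (K2E3-p23 (g4)): generic `exists_eq_exp_of_ne_zero`, `lt_exp_iff_le_exp_sub_one`, `normAbs_quadratic_le_of_v_lt` (reused)
import HarnessLib

/-!
# Road «GL₂-sc», brick (2E-a4): torus averaging on `Ḡ = GL₂(F) ⧸ Z` — the measure of the diagonal-collision set inside a torus-invariant set
# (the `N = 2` twin of ★ (GL-5) `K2E3GL3TorusAveraging`, K2E3-p23 (g4))

Cell `hodgecm-mathlib`, Track B, line `K2_E3_EllipticInputs`; road «GL₂-sc» = Harish-Chandra's local integrability for supercuspidal `GL₂(F)` (letter (S-C′-GL₂sc), socket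
`sig_K2E3GL2SupercuspidalCharLocInt`; road owner K2E5-p17 (g5), BRICK LIST v1.1 `K2/K2E5-p17/g5/BRICKLIST-GL2sc-v1.1.K2E5-p17-g5.md`).  Averaging over the compact torus
`T̄ = {diag(a,1) : |a| = 1}` turns the Haar measure of the SCALE-INVARIANT diagonal-collision set

  `N_j = mk '' {h | v((h₀₀ − h₁₁)²) < exp(−j) · v(h₀₀)²}`

inside any measurable `T̄`-invariant `B ⊆ Ḡ` into a one-variable quadratic sublevel set of units, which ★ (GL-D2) `unitsQuadraticFibre` bounds:

* §1 `isOpen_coll`, `scaleInvariant_coll` — the collision set is open and scale-invariant upstairs, so its image is open (★ 2F-a `isOpen_image_mk`) and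
  `mk h ∈ N ↔ h ∈ S` (★ 2F-a `mk_mem_image_iff`).
* §2 `measure_inter_image_le_of_fibre` — GENERIC (at `Fin 2`): if along every torus orbit the collision condition forces `|a² + c a + e| ≤ r` (`c, e` depending on the
  base point), then `μ̄(B ∩ mk '' S) ≤ C · r^κ · μ̄(B)` (★ FC-5b §1 + the fibre bound, `0 < μ'(𝒪^×) < ⊤`).
* §3 `fibre_coll` — the fibre computation: `Q(diag(a,1)·h) = h₀₀² (a² + c'a + e')`, `Q(g) = (g₀₀ − g₁₁)²` (★ 2E-a1 `diffSq_torusRow_mul`), so relative to `v(h₀₀)²` the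
  condition is `|a² + c'a + e'| ≤ |ϖ^j|` (★ generic `normAbs_quadratic_le_of_v_lt`).
* §4 **`measure_inter_coll_le`**: `∃ κ > 0, ∃ C ≠ ⊤, ∀ j B, … → μ̄(B ∩ N_j) ≤ C · |ϖ^j|^κ · μ̄(B)` — the `hdecay` input of ★ (F3a′) `lintegral_fibre_lt_top_of_boxDecay'` on `Ḡ`,
  once (2E-a3) puts the compact-centraliser part of the box inside `N_j`.

HONEST LABEL: HC_CM is proved only modulo the 7 printed citations (2 remaining named inputs: hLiu418 = stmt-HodgeConjecture-24832, h413 =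
stmt-HodgeConjecture-24833) until rung 0 closes; this file is count-neutral (kernel lane `--supports stmt-HodgeConjecture-24833 --as helper`).

References: Harish-Chandra 1970 (Part VII §2, the torus-averaging step of the finiteness of `∫ |F_f|` on the regular set) [cite: HarishChandra1970, Part VII §2 p. 69];
Weil 1965 (integration on homogeneous spaces) [cite: WeilIntegration1965, §7]; Cartier 1979 §IV [cite: Cartier1979, §IV.1].
-/

open MeasureTheory MeasureTheory.Measure Set Function Filter
open scoped NNReal ENNReal MatrixGroups Pointwise WithZero Valued Topology
open ValuativeRel Matrix
open Literature.NumberTheory.Automorphic Literature.NumberTheory.GaloisRepresentations Literature.NumberTheory.GaloisRepresentations.IsNonarchimedeanLocalField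
open Literature.NumberTheory.Automorphic.HermitianLattice
open Summit.HodgeConjecture.HodgeConjecture.Cruxes.H413.K2E3GL2ModCentre
open Summit.HodgeConjecture.HodgeConjecture.Cruxes.H413.K2E3GL2FinConjBoxes
open Summit.HodgeConjecture.HodgeConjecture.Cruxes.H413.K2E3SplitTorusTwistModuleBound

set_option linter.dupNamespace false

noncomputable section

namespace Summit.HodgeConjecture.HodgeConjecture.Cruxes.H413.K2E3GL2TorusAveraging


open K2E3GL3TorusAveraging (exists_eq_exp_of_ne_zero lt_exp_iff_le_exp_sub_one normAbs_quadratic_le_of_v_lt)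

/-! ## §1 The collision set: scale invariance and openness -/

section CollisionSets

variable {F : Type*} [Field F] [Valued F ℤᵐ⁰]

omit [Valued F ℤᵐ⁰] in
/-- Entries of `x · (c·1)` are the entries of `x` times `c`. [folklore] -/
theorem coe_mul_scalar_apply (x : GL (Fin 2) F) (c : Fˣ) (i j : Fin 2) :
    ((x * Matrix.GeneralLinearGroup.scalar (Fin 2) c : GL (Fin 2) F) : Matrix (Fin 2) (Fin 2) F) i j = (x : Matrix (Fin 2) (Fin 2) F) i j * (c : F) := by
  rw [Units.val_mul, Matrix.GeneralLinearGroup.coe_scalar, Matrix.scalar_apply, Matrix.mul_diagonal]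

/-- **SCALE INVARIANCE**: `{h | v((h₀₀ − h₁₁)²) < exp(−j) v(h₀₀)²}` is invariant under `h ↦ h · (c·1)` (both sides scale by `v(c)²`). [folklore] -/
theorem scaleInvariant_coll (j : ℕ) (c : Fˣ) (x : GL (Fin 2) F)
    (hx : x ∈ {h : GL (Fin 2) F | Valued.v (((h : Matrix (Fin 2) (Fin 2) F) 0 0 - (h : Matrix (Fin 2) (Fin 2) F) 1 1) ^ 2) <
      WithZero.exp (-(j : ℤ)) * Valued.v ((h : Matrix (Fin 2) (Fin 2) F) 0 0) ^ 2}) :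
    x * Matrix.GeneralLinearGroup.scalar (Fin 2) c ∈ {h : GL (Fin 2) F | Valued.v (((h : Matrix (Fin 2) (Fin 2) F) 0 0 - (h : Matrix (Fin 2) (Fin 2) F) 1 1) ^ 2) <
      WithZero.exp (-(j : ℤ)) * Valued.v ((h : Matrix (Fin 2) (Fin 2) F) 0 0) ^ 2} := by
  simp only [mem_setOf_eq, coe_mul_scalar_apply] at hx ⊢
  have hq : ((x : Matrix (Fin 2) (Fin 2) F) 0 0 * c - (x : Matrix (Fin 2) (Fin 2) F) 1 1 * c) ^ 2 =
      (((x : Matrix (Fin 2) (Fin 2) F) 0 0 - (x : Matrix (Fin 2) (Fin 2) F) 1 1) ^ 2) * ((c : F) * c) := by ring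
  have hc0 : (0 : ℤᵐ⁰) < Valued.v (c : F) * Valued.v (c : F) := zero_lt_iff.2 (mul_ne_zero ((Valuation.ne_zero_iff _).2 c.ne_zero) ((Valuation.ne_zero_iff _).2 c.ne_zero))
  rw [hq, map_mul, map_mul, map_mul, mul_pow]
  have := mul_lt_mul_of_pos_right hx hc0
  calc _ < WithZero.exp (-(j : ℤ)) * Valued.v ((x : Matrix (Fin 2) (Fin 2) F) 0 0) ^ 2 * (Valued.v (c : F) * Valued.v (c : F)) := this
    _ = _ := by rw [pow_two (Valued.v (c : F))]; simp only [mul_assoc]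

/-- **OPENNESS (generic)**: for continuous `Q, ℓ : GL₂(F) → F`, the set `{h | v(Q h) < exp(−j) · v(ℓ h)²}` is open (`v ∘ ℓ` is locally constant where it is nonzero, and
`{v ≤ exp m}` is open ★). [cite: Cartier1979, §IV.1] -/
theorem isOpen_setOf_v_lt_exp_mul_sq {ϖ : F} (hϖ : Valued.v ϖ = WithZero.exp (-1 : ℤ)) (j : ℕ) {Q ℓ : GL (Fin 2) F → F} (hQ : Continuous Q) (hℓ : Continuous ℓ) :
    IsOpen {h : GL (Fin 2) F | Valued.v (Q h) < WithZero.exp (-(j : ℤ)) * Valued.v (ℓ h) ^ 2} := by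
  rw [isOpen_iff_mem_nhds]
  intro g hg
  have h00 : Valued.v (ℓ g) ≠ 0 := by
    intro h0
    rw [mem_setOf_eq, h0, zero_pow two_ne_zero, mul_zero] at hg
    exact not_lt_zero hg
  obtain ⟨k, hk⟩ := exists_eq_exp_of_ne_zero h00
  have hrhs : ∀ y : ℤᵐ⁰, y = WithZero.exp k → WithZero.exp (-(j : ℤ)) * y ^ 2 = WithZero.exp (-(j : ℤ) + (k + k)) := by
    rintro y rfl
    rw [pow_two, ← WithZero.exp_add, ← WithZero.exp_add]
  have hA : {h : GL (Fin 2) F | Valued.v (ℓ h) = Valued.v (ℓ g)} ∈ 𝓝 g := hℓ.continuousAt.preimage_mem_nhds (Valued.locally_const h00)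
  have hB : {h : GL (Fin 2) F | Valued.v (Q h) ≤ WithZero.exp (-(j : ℤ) + (k + k) - 1)} ∈ 𝓝 g := by
    refine ((isOpen_setOf_v_le_exp_int hϖ _).preimage hQ).mem_nhds ?_
    show Valued.v (Q g) ≤ WithZero.exp (-(j : ℤ) + (k + k) - 1)
    rw [← lt_exp_iff_le_exp_sub_one, ← hrhs _ hk]
    exact hg
  filter_upwards [hA, hB] with h hhA hhB
  show Valued.v (Q h) < WithZero.exp (-(j : ℤ)) * Valued.v (ℓ h) ^ 2
  rw [show Valued.v (ℓ h) = Valued.v (ℓ g) from hhA, hrhs _ hk, lt_exp_iff_le_exp_sub_one]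
  exact hhB

/-- The entry maps `h ↦ h i j` are continuous on `GL₂(F)`. [folklore] -/
theorem continuous_apply_coe (i j : Fin 2) : Continuous fun h : GL (Fin 2) F => (h : Matrix (Fin 2) (Fin 2) F) i j :=
  Units.continuous_val.matrix_elem i j

/-- **The collision set is open.** [cite: Cartier1979, §IV.1] -/
theorem isOpen_coll {ϖ : F} (hϖ : Valued.v ϖ = WithZero.exp (-1 : ℤ)) (j : ℕ) :
    IsOpen {h : GL (Fin 2) F | Valued.v (((h : Matrix (Fin 2) (Fin 2) F) 0 0 - (h : Matrix (Fin 2) (Fin 2) F) 1 1) ^ 2) <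
      WithZero.exp (-(j : ℤ)) * Valued.v ((h : Matrix (Fin 2) (Fin 2) F) 0 0) ^ 2} :=
  isOpen_setOf_v_lt_exp_mul_sq hϖ j (((continuous_apply_coe 0 0).sub (continuous_apply_coe 1 1)).pow 2) (continuous_apply_coe 0 0)

/-- The torus maps `a ↦ diag(d(a))` are continuous for continuous `d : F^× → (Fin 2 → F^×)`. [folklore] -/
theorem continuous_diagonalGL_comp {d : Fˣ → Fin 2 → Fˣ} (hd : Continuous d) : Continuous fun a : Fˣ => diagonalGL (Fin 2) F (d a) := by
  haveI : IsTopologicalRing F := inferInstance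
  have hdi : ∀ i : Fin 2, Continuous fun a : Fˣ => d a i := fun i => continuous_pi_iff.1 hd i
  refine Units.continuous_iff.mpr ⟨?_, ?_⟩
  · show Continuous fun a : Fˣ => ((diagonalGL (Fin 2) F (d a) : GL (Fin 2) F) : Matrix (Fin 2) (Fin 2) F)
    have h : (fun a : Fˣ => ((diagonalGL (Fin 2) F (d a) : GL (Fin 2) F) : Matrix (Fin 2) (Fin 2) F)) = fun a => Matrix.diagonal fun i => ((d a i : Fˣ) : F) :=
      funext fun a => coe_diagonalGL (d a)
    rw [h]
    exact (continuous_pi fun i => Units.continuous_val.comp (hdi i)).matrix_diagonal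
  · show Continuous fun a : Fˣ => (((diagonalGL (Fin 2) F (d a))⁻¹ : GL (Fin 2) F) : Matrix (Fin 2) (Fin 2) F)
    have h : (fun a : Fˣ => (((diagonalGL (Fin 2) F (d a))⁻¹ : GL (Fin 2) F) : Matrix (Fin 2) (Fin 2) F)) = fun a => Matrix.diagonal fun i => (((d a i)⁻¹ : Fˣ) : F) := by
      funext a
      rw [← map_inv, coe_diagonalGL]
      rfl
    rw [h]
    exact (continuous_pi fun i => Units.continuous_coe_inv.comp (hdi i)).matrix_diagonal

/-- `a ↦ ![a, 1]` is continuous. [folklore] -/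
theorem continuous_vec_one : Continuous fun a : Fˣ => (![a, 1] : Fin 2 → Fˣ) :=
  continuous_pi fun i => by
    have hi : i = 0 ∨ i = 1 := by decide +revert
    rcases hi with rfl | rfl
    · exact continuous_id
    · exact continuous_const

end CollisionSets

/-! ## §2 Generic torus averaging on `Ḡ` against a units fibre bound -/

section Averaging

variable {F : Type*} [Field F] [Valued F ℤᵐ⁰] [ValuativeRel F] [(Valued.v : Valuation F ℤᵐ⁰).Compatible] [IsNonarchimedeanLocalField F]
  [MeasurableSpace Fˣ] [BorelSpace Fˣ] (μ' : Measure Fˣ) [μ'.IsHaarMeasure]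
  [MeasurableSpace (GL (Fin 2) F ⧸ Subgroup.center (GL (Fin 2) F))] [BorelSpace (GL (Fin 2) F ⧸ Subgroup.center (GL (Fin 2) F))]
  (μ : Measure (GL (Fin 2) F ⧸ Subgroup.center (GL (Fin 2) F))) [μ.IsMulLeftInvariant] [SFinite μ]

omit [(Valued.v : Valuation F ℤᵐ⁰).Compatible] in
/-- **GENERIC TORUS AVERAGING ON `Ḡ`.**  Let `τ : F^× → GL₂(F)` be continuous, `S ⊆ GL₂(F)` open and scale-invariant, and suppose that along every torus orbit the
condition `τ(a) · y ∈ S` (`|a| = 1`) forces `|a² + c a + e| ≤ r` for some `c, e` depending on `y`.  If the units fibre bound `μ'{|a| = 1, |a² + c a + e| ≤ r} ≤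
C r^κ μ'(𝒪^×)` holds for all `c, e` (★ GL-D2), then for every measurable `B ⊆ Ḡ` invariant under the compact torus `mk ∘ τ(𝒪^×)`:
`μ̄(B ∩ mk '' S) ≤ C · r^κ · μ̄(B)` (★ FC-5b §1 averaging, `0 < μ'(𝒪^×) < ⊤` ★). [cite: HarishChandra1970, Part VII §2 p. 69] [cite: WeilIntegration1965, §7] -/
theorem measure_inter_image_le_of_fibre {κ : ℝ} {C : ℝ≥0∞} {r : ℝ≥0}
    (hD : ∀ c e : F, μ' {a : Fˣ | valuation F (a : F) = 1 ∧ normAbs F (((a : F) * 1) ^ 2 + c * ((a : F) * 1) + e) ≤ r} ≤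
      C * (r : ℝ≥0∞) ^ κ * μ' {a : Fˣ | valuation F (a : F) = 1})
    (τ : Fˣ → GL (Fin 2) F) (hτ : Continuous τ) {S : Set (GL (Fin 2) F)} (hSo : IsOpen S)
    (hS : ∀ (c : Fˣ) (x : GL (Fin 2) F), x ∈ S → x * Matrix.GeneralLinearGroup.scalar (Fin 2) c ∈ S)
    (hfib : ∀ y : GL (Fin 2) F, ∃ c e : F, ∀ a : Fˣ, valuation F (a : F) = 1 → τ a * y ∈ S → normAbs F (((a : F) * 1) ^ 2 + c * ((a : F) * 1) + e) ≤ r)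
    {B : Set (GL (Fin 2) F ⧸ Subgroup.center (GL (Fin 2) F))} (hBm : MeasurableSet B)
    (hB : ∀ a : Fˣ, valuation F (a : F) = 1 → (QuotientGroup.mk (τ a) : GL (Fin 2) F ⧸ Subgroup.center (GL (Fin 2) F)) • B = B) :
    μ (B ∩ (QuotientGroup.mk : GL (Fin 2) F → GL (Fin 2) F ⧸ Subgroup.center (GL (Fin 2) F)) '' S) ≤ C * (r : ℝ≥0∞) ^ κ * μ B := by
  haveI : SecondCountableTopology (GL (Fin 2) F) := secondCountableTopology_gl2 F
  haveI : SecondCountableTopology Fˣ := secondCountableTopology_units F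
  set τ' : Fˣ → GL (Fin 2) F ⧸ Subgroup.center (GL (Fin 2) F) := fun a => QuotientGroup.mk (τ a) with hτ'
  set N : Set (GL (Fin 2) F ⧸ Subgroup.center (GL (Fin 2) F)) := (QuotientGroup.mk : GL (Fin 2) F → GL (Fin 2) F ⧸ Subgroup.center (GL (Fin 2) F)) '' S with hN
  set U : Set Fˣ := {a : Fˣ | valuation F (a : F) = 1} with hU
  have hNm : MeasurableSet N := (isOpen_image_mk hSo).measurableSet
  have hUm : MeasurableSet U := (isOpen_units_valuation_eq_one (F := F)).measurableSet
  have hU0 : μ' U ≠ 0 := ((isOpen_units_valuation_eq_one (F := F)).measure_pos μ' ⟨1, by simp⟩).ne'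
  have hUt : μ' U ≠ ⊤ := ((isCompact_units_valuation_eq_one (F := F)).measure_lt_top (μ := μ')).ne
  have hτ'c : Continuous τ' := QuotientGroup.continuous_mk.comp hτ
  have hm : Continuous fun p : Fˣ × (GL (Fin 2) F ⧸ Subgroup.center (GL (Fin 2) F)) => τ' p.1 * p.2 := (hτ'c.comp continuous_fst).mul continuous_snd
  have hF : Measurable fun p : Fˣ × (GL (Fin 2) F ⧸ Subgroup.center (GL (Fin 2) F)) => N.indicator (fun _ => (1 : ℝ≥0∞)) (τ' p.1 * p.2) :=
    (measurable_const.indicator hNm).comp hm.measurable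
  have hB' : ∀ a ∈ U, τ' a • B = B := fun a ha => hB a ha
  have key := K2E3TorusOneAveraging.measure_mul_setLIntegral_le_measure_mul_iSup μ τ' hBm hB' μ' hUm hF
  have hlhs : ∫⁻ x in B, N.indicator (fun _ => (1 : ℝ≥0∞)) x ∂μ = μ (B ∩ N) := by
    rw [lintegral_indicator_const hNm, Measure.restrict_apply hNm, one_mul, inter_comm]
  rw [hlhs] at key
  -- the fibre bound, orbit by orbit
  have hrhs : ∀ x, ∫⁻ a in U, N.indicator (fun _ => (1 : ℝ≥0∞)) (τ' a * x) ∂μ' ≤ C * (r : ℝ≥0∞) ^ κ * μ' U := by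
    intro x
    obtain ⟨y, rfl⟩ := QuotientGroup.mk_surjective x
    obtain ⟨c, e, hce⟩ := hfib y
    have hpre : MeasurableSet ((fun a => τ' a * (QuotientGroup.mk y : GL (Fin 2) F ⧸ Subgroup.center (GL (Fin 2) F))) ⁻¹' N) :=
      hNm.preimage (hτ'c.mul continuous_const).measurable
    have hind : (fun a => N.indicator (fun _ => (1 : ℝ≥0∞)) (τ' a * (QuotientGroup.mk y : GL (Fin 2) F ⧸ Subgroup.center (GL (Fin 2) F)))) =
        ((fun a => τ' a * (QuotientGroup.mk y : GL (Fin 2) F ⧸ Subgroup.center (GL (Fin 2) F))) ⁻¹' N).indicator (fun _ => (1 : ℝ≥0∞)) := by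
      funext a
      by_cases h : τ' a * (QuotientGroup.mk y : GL (Fin 2) F ⧸ Subgroup.center (GL (Fin 2) F)) ∈ N
      · rw [indicator_of_mem h, indicator_of_mem (show a ∈ (fun a => τ' a * (QuotientGroup.mk y : GL (Fin 2) F ⧸ Subgroup.center (GL (Fin 2) F))) ⁻¹' N from h)]
      · rw [indicator_of_notMem h, indicator_of_notMem (show a ∉ (fun a => τ' a * (QuotientGroup.mk y : GL (Fin 2) F ⧸ Subgroup.center (GL (Fin 2) F))) ⁻¹' N from h)]
    rw [hind, lintegral_indicator_const hpre, Measure.restrict_apply hpre, one_mul]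
    refine (measure_mono ?_).trans (hD c e)
    rintro a ⟨ha, haU⟩
    refine ⟨haU, hce a haU ?_⟩
    have ha' : (QuotientGroup.mk (τ a * y) : GL (Fin 2) F ⧸ Subgroup.center (GL (Fin 2) F)) ∈ N := by
      rw [QuotientGroup.mk_mul]; exact ha
    exact (mk_mem_image_iff hS _).1 ha'
  have hsup : (⨆ x ∈ B, ∫⁻ a in U, N.indicator (fun _ => (1 : ℝ≥0∞)) (τ' a * x) ∂μ') ≤ C * (r : ℝ≥0∞) ^ κ * μ' U := iSup₂_le fun x _ => hrhs x
  have h2 : μ' U * μ (B ∩ N) ≤ μ' U * (C * (r : ℝ≥0∞) ^ κ * μ B) := by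
    calc μ' U * μ (B ∩ N) ≤ μ B * (C * (r : ℝ≥0∞) ^ κ * μ' U) := key.trans (mul_le_mul' le_rfl hsup)
      _ = μ' U * (C * (r : ℝ≥0∞) ^ κ * μ B) := by ring
  calc μ (B ∩ N) = (μ' U)⁻¹ * (μ' U * μ (B ∩ N)) := by rw [← mul_assoc, ENNReal.inv_mul_cancel hU0 hUt, one_mul]
    _ ≤ (μ' U)⁻¹ * (μ' U * (C * (r : ℝ≥0∞) ^ κ * μ B)) := mul_le_mul' le_rfl h2
    _ = C * (r : ℝ≥0∞) ^ κ * μ B := by rw [← mul_assoc, ENNReal.inv_mul_cancel hU0 hUt, one_mul]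

end Averaging

/-! ## §3 The fibre computation: `Q(diag·h)` relative to the scaled diagonal entry -/

section Fibre

variable {F : Type*} [Field F] [Valued F ℤᵐ⁰] [ValuativeRel F] [(Valued.v : Valuation F ℤᵐ⁰).Compatible] [IsNonarchimedeanLocalField F]

/-- **FIBRE**: for `y ∈ GL₂(F)` there are `c, e` with: `v(a) = 1` and `diag(a,1) · y ∈ {v((h₀₀ − h₁₁)²) < exp(−j) v(h₀₀)²}` imply `|a² + c a + e| ≤ |ϖ^j|`
(★ 2E-a1 `diffSq_torusRow_mul`; if `y₀₀ = 0` the collision condition is void). [cite: HarishChandra1970, Part VII §2 p. 69] -/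
theorem fibre_coll {ϖ : F} (hϖ : Valued.v ϖ = WithZero.exp (-1 : ℤ)) (j : ℕ) (y : GL (Fin 2) F) :
    ∃ c e : F, ∀ a : Fˣ, valuation F (a : F) = 1 →
      diagonalGL (Fin 2) F ![a, 1] * y ∈ {h : GL (Fin 2) F | Valued.v (((h : Matrix (Fin 2) (Fin 2) F) 0 0 - (h : Matrix (Fin 2) (Fin 2) F) 1 1) ^ 2) <
        WithZero.exp (-(j : ℤ)) * Valued.v ((h : Matrix (Fin 2) (Fin 2) F) 0 0) ^ 2} →
      normAbs F (((a : F) * 1) ^ 2 + c * ((a : F) * 1) + e) ≤ normAbs F (ϖ ^ j) := by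
  set x₀ : F := (y : Matrix (Fin 2) (Fin 2) F) 0 0 with hx₀
  refine ⟨(-(2 * (y : Matrix (Fin 2) (Fin 2) F) 1 1)) / x₀, ((y : Matrix (Fin 2) (Fin 2) F) 1 1 ^ 2) / x₀ ^ 2, fun a ha hmem => ?_⟩
  have ha' : Valued.v (a : F) = 1 := (v_eq_one_iff_valuation_eq_one _).2 ha
  rw [mem_setOf_eq, diffSq_torusRow_mul, coe_diagonalGL_mul_apply] at hmem
  simp only [Matrix.cons_val_zero] at hmem
  by_cases h0 : x₀ = 0
  · exfalso
    rw [← hx₀, h0, mul_zero, map_zero, zero_pow two_ne_zero, mul_zero] at hmem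
    exact not_lt_zero hmem
  exact normAbs_quadratic_le_of_v_lt hϖ j h0 _ _ a ha' hmem

end Fibre

/-! ## §4 The decay estimate -/

section Decay

variable {F : Type*} [Field F] [Valued F ℤᵐ⁰] [ValuativeRel F] [(Valued.v : Valuation F ℤᵐ⁰).Compatible] [IsNonarchimedeanLocalField F] [CharZero F]
  [MeasurableSpace Fˣ] [BorelSpace Fˣ] (μ' : Measure Fˣ) [μ'.IsHaarMeasure]
  [MeasurableSpace (GL (Fin 2) F ⧸ Subgroup.center (GL (Fin 2) F))] [BorelSpace (GL (Fin 2) F ⧸ Subgroup.center (GL (Fin 2) F))]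
  (μ : Measure (GL (Fin 2) F ⧸ Subgroup.center (GL (Fin 2) F))) [μ.IsMulLeftInvariant] [SFinite μ]

include μ' in
/-- **(2E-a4) THE DECAY**: `∃ κ > 0, ∃ C ≠ ⊤, ∀ j, ∀ B ⊆ Ḡ` measurable with `mk(diag(a,1)) • B = B` (`|a| = 1`):
`μ̄(B ∩ mk '' {v((h₀₀ − h₁₁)²) < exp(−j) v(h₀₀)²}) ≤ C · |ϖ^j|^κ · μ̄(B)` (★ GL-D2 inside the torus average). [cite: HarishChandra1970, Part VII §2 p. 69]
[cite: Rogawski1990, §1.10 p. 9] -/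
theorem measure_inter_coll_le {ϖ : F} (hϖ : Valued.v ϖ = WithZero.exp (-1 : ℤ)) :
    ∃ κ : ℝ, 0 < κ ∧ ∃ C : ℝ≥0∞, C ≠ ⊤ ∧ ∀ j : ℕ, ∀ B : Set (GL (Fin 2) F ⧸ Subgroup.center (GL (Fin 2) F)), MeasurableSet B →
      (∀ a : Fˣ, valuation F (a : F) = 1 →
        (QuotientGroup.mk (diagonalGL (Fin 2) F ![a, 1]) : GL (Fin 2) F ⧸ Subgroup.center (GL (Fin 2) F)) • B = B) →
      μ (B ∩ (QuotientGroup.mk : GL (Fin 2) F → GL (Fin 2) F ⧸ Subgroup.center (GL (Fin 2) F)) ''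
          {h : GL (Fin 2) F | Valued.v (((h : Matrix (Fin 2) (Fin 2) F) 0 0 - (h : Matrix (Fin 2) (Fin 2) F) 1 1) ^ 2) <
            WithZero.exp (-(j : ℤ)) * Valued.v ((h : Matrix (Fin 2) (Fin 2) F) 0 0) ^ 2}) ≤
        C * ((normAbs F (ϖ ^ j) : ℝ≥0∞)) ^ κ * μ B := by
  obtain ⟨κ, hκ, C, hC, h5⟩ := K2E3UnitsQuadraticFibre.unitsQuadraticFibre μ'
  refine ⟨κ, hκ, C, hC, fun j B hBm hB => ?_⟩
  exact measure_inter_image_le_of_fibre μ' μ (fun c e => h5 _ 1 c e (map_one _)) _ (continuous_diagonalGL_comp continuous_vec_one)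
    (isOpen_coll hϖ j) (fun c x hx => scaleInvariant_coll j c x hx) (fibre_coll hϖ j) hBm hB

end Decay

end Summit.HodgeConjecture.HodgeConjecture.Cruxes.H413.K2E3GL2TorusAveraging

end
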